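import Mathlib.LinearAlgebra.Alternating.Uncurry.Fin
import Mathlib.Algebra.MvPolynomial.PDeriv
import Mathlib.RingTheory.Derivation.Lie
import Mathlib.RingTheory.Nullstellensatz
import Mathlib.RingTheory.Smooth.Basic
import Mathlib.LinearAlgebra.Quotient.Basic
import Mathlib.Analysis.Complex.Basic
import Literature.AlgebraicTopology.SingularHomology.SingularCochains
import HarnessLib

/-!
# The algebraic de Rham complex of a closed subscheme of affine space, and Grothendieck's
# comparison theorem for smooth affine varieties over `ℂ`

Topic `Literature/AlgebraicGeometry/Motives` (definition request `defn-AffineAlgebraicDeRham`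
of route `KontsevichZagierPeriods/LinkTwistWrithe`, informal crux `HopfInvariantScaling`).

Let `k` be a commutative ring, `P = k[x₁, …, xₙ]` and `I ⊆ P` an ideal, `A = P/I`,
`X = Spec A ⊆ 𝔸ⁿ_k` the closed subscheme it cuts out (first instances for the requester: the
spheres `Σ xᵢ² = 1` in `𝔸³_ℚ`, `𝔸⁴_ℚ`). This file defines, concretely and sorry-free,

* `AffineDeRham.PolyForm k n p` — the `P`-module `Ω^p_{P/k}` of **polynomial `p`-forms on affine
  `n`-space**: a form `Σ_J ω_J dx_J` is encoded by its (alternating) coefficient system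
  `(e_{j₁}, …, e_{j_p}) ↦ ω_J ∈ P`, packaged as an alternating multilinear map `(ℤⁿ)^p → P` on the
  lattice `ℤⁿ` of *constant integer vector fields* — the value of the form on `p` such fields
  (Mathlib's model `E [⋀^Fin p]→L[𝕜] F` of a form on a normed space,
  `Mathlib.Analysis.Calculus.DifferentialForm`, with polynomial instead of smooth dependence on
  the point, and with the arguments restricted to the standard lattice, on whose basis tuples an
  alternating map is freely and uniquely prescribed — `Module.Basis.ext_alternating` — so that
  nothing is lost and base change of the coefficient ring becomes post-composition,
  `AffineDeRham.PolyForm.map`);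
* `AffineDeRham.extDeriv` — the exterior derivative `d : Ω^p → Ω^{p+1}`,
  `dω(v₀, …, v_p) = Σᵢ (−1)ⁱ ∂_{vᵢ} ω(v₀, …, v̂ᵢ, …, v_p)` (Mathlib's normalisation of
  `extDeriv`, built with `AlternatingMap.alternatizeUncurryFin`), with `d ∘ d = 0`
  (`extDeriv_extDeriv`, from the symmetry of second partial derivatives), the Leibniz rule
  `d(f ω) = df ∧ ω + f dω` (`extDeriv_smul`, `AffineDeRham.dWedge f ω = df ∧ ω`) and the
  anticommutativity `df ∧ (dg ∧ η) = −dg ∧ (df ∧ η)` (`dWedge_dWedge`, deduced from `d ∘ d = 0`);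
* `AffineDeRham.vanishingForms I p ⊆ Ω^p_{P/k}` — the forms that **vanish on `X`**: the
  differential-graded ideal generated by `I`, i.e. `I·Ω^p + dI ∧ Ω^{p-1}`, defined wedge-free by
  recursion on the degree as `I·Ω⁰ = I`, `I·Ω^{p+1} + P·d(vanishingForms I p)`; the two
  descriptions agree (`vanishingForms_eq_dgIdealSpan`, `vanishingForms_succ`: PROVED, using
  `df ∧ η = d(f η) − f dη`, `d(df ∧ η) = −df ∧ dη` and the anticommutativity), and it is the
  smallest family of `P`-submodules containing `I·Ω^•` and stable under `d` (`vanishingForms_le`);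
* `AffineDeRham.RegularForm I p := Ω^p_{P/k} ⧸ vanishingForms I p` — the **regular (Kähler)
  `p`-forms on `X` over `k`**, `Γ(X, Ω^p_{X/k}) = Ω^p_{A/k} = ⋀^p_A Ω_{A/k}` for the affine scheme
  `X = Spec (P/I)` (conormal sequence `I/I² → Ω_{P/k} ⊗ A → Ω_{A/k} → 0` and
  `⋀^p (M/N) = ⋀^p M / (N ∧ ⋀^{p-1} M)`), with the induced `k`-linear differential
  `RegularForm.d`, `d ∘ d = 0`, closed and exact forms, and
* `AffineDeRham.DeRhamCohomology I p` — the **algebraic de Rham cohomology**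
  `H^p_dR(X/k) = H^p(Γ(X, Ω^•_{X/k}))` of the affine `k`-scheme `X` (Grothendieck 1966, (4):
  for `X` affine the hypercohomology of `Ω^•_{X/k}` "is what one might naively think");
* representative-level predicates `AffineDeRham.IsClosedOn I ω` (`dω` vanishes on `X`) and
  `AffineDeRham.IsExactOn I ω` (`ω − dη` vanishes on `X` for some polynomial form `η`), which is
  the interface a computation uses (`mk_mem_closedForms_iff`, `mk_mem_exactForms_iff`);

and states the NAMED FACT

* `AffineAlgebraicDeRham` — **Grothendieck's algebraic de Rham theorem, affine case**
  [Grothendieck1966, Thm 1]: for `X = Spec (ℂ[x₁, …, xₙ]/I)` smooth over `ℂ` ("regular"), the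
  complex cohomology `H^p(X(ℂ); ℂ)` of the space of complex points `X(ℂ) = V(I) ⊆ ℂⁿ` (analytic
  topology; `MvPolynomial.zeroLocus ℂ I` with the subspace topology of `ℂⁿ`) is computed by the
  algebraic de Rham complex: `H^p_dR(X/ℂ) ≅ H^p(X(ℂ); ℂ)` for every `p`, singular cohomology being
  the tree's `Literature.AlgebraicTopology.SingularHomology.singularCohomology`;

with the proved corollary the requester uses:

* `AffineAlgebraicDeRham.isExactOn_of_subsingleton` — if `H^{p+1}(X(ℂ); ℂ) = 0` then every
  polynomial `(p+1)`-form closed on `X` is, on `X`, the differential of a polynomial `p`-form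
  (e.g. `H¹ = H² = 0` for the complex affine quadric `Σ zᵢ² = 1` of dimension `3`, which retracts
  onto `S³`; `H¹ = 0` in dimension `2`).

## What is NOT here (and why)

* The comparison *map*. The printed theorem [Grothendieck1966, Thm 1′] says that the canonical
  map (5) `H^•_dR(X) → H^•(X^h, Ω^•_{X^h}) ≅ H^•(X^h, ℂ)` (restriction of algebraic to holomorphic
  forms, followed by the holomorphic Poincaré lemma / de Rham's theorem) is an isomorphism. The
  tree has no de Rham homomorphism from forms to singular cochains (de Rham's theorem is the
  hypothesis structure `Literature.NumberTheory.Transcendental.DeRhamIsoFamily`), so the fact is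
  vendored in the form "can be calculated as" of [Grothendieck1966, Thm 1]: existence of a
  `ℂ`-linear isomorphism in each degree. This is implied by, and strictly weaker than, the printed
  statement; it already yields the kernel statement in the vanishing range
  (`isExactOn_of_subsingleton`). The general kernel statement "a closed regular form whose class
  vanishes in `H^p(X(ℂ); ℂ)` is exact" needs the map and is not stated.
* Descent of exactness from `ℂ` to a subfield `k ⊆ ℂ` (for `I ⊆ k[x]`, a `k`-form exact over `ℂ`
  is exact over `k`: `Ω^•_{P_ℂ} = Ω^•_{P_k} ⊗_k ℂ`, `d` and `vanishingForms` commute with the base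
  change, and a `k`-linear retraction `ℂ → k` maps a complex primitive to a `k`-primitive) is
  linear algebra on top of this file and is left to a sequel; so is the identification of
  `RegularForm I 1` with Mathlib's `Ω[A⁄k]` (`KaehlerDifferential`) through the conormal sequence,
  and pull-back of forms along polynomial maps.
* No scheme theory is used: everything is stated for an ideal of a polynomial ring, which is the
  generality the requester computes in; smoothness of `X` enters only the named fact, as Mathlib's
  `Algebra.Smooth ℂ (P ⧸ I)`.

## Design notes

* Forms are alternating `ℤ`-multilinear maps on `Fin n → ℤ` with values in `P`, so `PolyForm k n p`
  is at once a `k`-module and a `P`-module (`AlternatingMap.instModule`), `d` is built over `ℤ`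
  (`alternatizeUncurryFin` with `R = ℤ`; the directional derivative `∂_v`, `v ∈ ℤⁿ`, is a
  `k`-derivation), and a ring map `φ : k →+* k'` acts on forms coefficientwise
  (`PolyForm.map`, commuting with `d`). The arguments could equivalently range over `kⁿ`: an
  alternating map out of a free module is determined by its values on basis tuples, and these
  values are unconstrained beyond alternation. The missing Prop-valued tower
  instance `IsScalarTower k P (PolyForm k n p)` is supplied (`instIsScalarTowerPolyForm`, a
  Mathlib gap; it carries no data). `d` is only `k`-linear, so the quotient by the `P`-submodule
  `vanishingForms I p` is compared with the quotient by its restriction of scalars through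
  Mathlib's `Submodule.Quotient.restrictScalarsEquiv`.
* `vanishingForms`, `exactForms` and `IsExactOn` are defined by pattern matching on the degree
  (no natural-number subtraction), as in `Literature.Geometry.Kaehler.exactSmoothForms`.
* Signs: `extDeriv_apply` is stated in `simp`-normal form, the sign `(-1)^i` living in `P`.

## References

* [Grothendieck1966] A. Grothendieck, *On the de Rham cohomology of algebraic varieties*,
  Publ. Math. IHÉS 29 (1966) 95–103: Thm 1 (affine, p. 95), eq. (4) (affine hypercohomology =
  cohomology of global forms, p. 96), Thm 1′ (the canonical map (5) is an isomorphism, p. 96).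
* [Hartshorne1975] R. Hartshorne, *On the de Rham cohomology of algebraic varieties*, Publ. Math.
  IHÉS 45 (1975): Ch. II §1 (algebraic de Rham cohomology of an embedded scheme), Ch. IV
  Thm 1.1 (global comparison theorem, generalising Grothendieck's).
* [Hartshorne1977] R. Hartshorne, *Algebraic Geometry*, II.8 (Kähler differentials; Prop. 8.4A,
  the conormal sequence; Ex. 8.3).
* [Warner1983] F. Warner, *Foundations of differentiable manifolds and Lie groups*, Ch. 2
  (exterior derivative, its invariant formula; the smooth model copied here).
-/

noncomputable section

open MvPolynomial

namespace Literature.AlgebraicGeometry.Motives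

namespace AffineDeRham

variable {k : Type*} [CommRing k] {n : ℕ}

/-! ### Polynomial differential forms on affine space -/

/-- **Polynomial `p`-forms on affine `n`-space over `k`**, `Ω^p_{P/k}` for `P = k[x₁, …, xₙ]`:
a form `ω = Σ_J ω_J dx_J` (`J` strictly increasing, `ω_J ∈ P`) is recorded as the alternating
multilinear map `(ℤⁿ)^p → P` sending a `p`-tuple `(v₁, …, v_p)` of *constant integer vector
fields* (elements of the standard lattice `ℤⁿ`) to the polynomial `ω(v₁, …, v_p)`, so that
`ω_J = ω(e_{j₁}, …, e_{j_p})`; an alternating map on the free module `ℤⁿ` is freely and uniquely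
determined by these coefficients, so this is exactly the free `P`-module on the `dx_J`. It is a
module over `P` (pointwise) and over `k`. This is the polynomial analogue of Mathlib's model
`E → E [⋀^Fin p]→L[𝕜] F` of differential forms on a vector space. [folklore] -/
abbrev PolyForm (k : Type*) [CommRing k] (n p : ℕ) : Type _ :=
  (Fin n → ℤ) [⋀^Fin p]→ₗ[ℤ] MvPolynomial (Fin n) k

/-- The `k`- and `P`-module structures on polynomial forms are compatible (pointwise
`(a • f) • ω v = a • (f • ω v)`). Mathlib has no `IsScalarTower` instance for alternating maps;
this Prop-valued instance fills the gap. [folklore] -/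
instance instIsScalarTowerPolyForm (p : ℕ) :
    IsScalarTower k (MvPolynomial (Fin n) k) (PolyForm k n p) :=
  ⟨fun a f ω => AlternatingMap.ext fun v => smul_assoc a f (ω v)⟩

/-- The `0`-form attached to a polynomial: `Ω⁰_{P/k} = P` (a `P`-linear isomorphism onto the
forms of degree `0`, which are the constant maps on the empty tuple). [folklore] -/
def ofPoly : MvPolynomial (Fin n) k ≃ₗ[MvPolynomial (Fin n) k] PolyForm k n 0 where
  toFun f := AlternatingMap.constOfIsEmpty ℤ (Fin n → ℤ) (Fin 0) f
  map_add' _ _ := rfl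
  map_smul' _ _ := rfl
  invFun ω := ω 0
  left_inv _ := rfl
  right_inv ω := AlternatingMap.ext fun _ => AlternatingMap.congr_arg ω (Subsingleton.elim _ _)

/-- The `0`-form of `f` takes the value `f` (on the empty tuple of vector fields). [folklore] -/
@[simp]
theorem ofPoly_apply (f : MvPolynomial (Fin n) k) (v : Fin 0 → Fin n → ℤ) : ofPoly f v = f :=
  rfl

/-! ### Directional derivatives along constant vector fields -/

/-- The derivative `∂_v = Σᵢ vᵢ ∂/∂xᵢ` of polynomials along the constant vector field
`v ∈ ℤⁿ`, as a `k`-derivation of `P = k[x₁, …, xₙ]` (the derivation with `∂_v xᵢ = vᵢ`).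
[folklore] -/
def dirDeriv (v : Fin n → ℤ) :
    Derivation k (MvPolynomial (Fin n) k) (MvPolynomial (Fin n) k) :=
  MvPolynomial.mkDerivation k (fun i => C (v i : k))

/-- `∂_v xᵢ = vᵢ`. [folklore] -/
@[simp]
theorem dirDeriv_X (v : Fin n → ℤ) (i : Fin n) : dirDeriv v (X i) = C (v i : k) := by
  simp [dirDeriv]

/-- `∂_{v+w} = ∂_v + ∂_w`. [folklore] -/
theorem dirDeriv_add (v w : Fin n → ℤ) :
    (dirDeriv (v + w) : Derivation k (MvPolynomial (Fin n) k) _) = dirDeriv v + dirDeriv w :=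
  derivation_ext fun i => by simp [dirDeriv_X]

/-- `∂_{c v} = c ∂_v` for an integer `c`. [folklore] -/
theorem dirDeriv_smul (c : ℤ) (v : Fin n → ℤ) :
    (dirDeriv (c • v) : Derivation k (MvPolynomial (Fin n) k) _) = c • dirDeriv v :=
  derivation_ext fun i => by simp [dirDeriv_X, zsmul_eq_mul]

/-- Along a coordinate vector `∂_{eᵢ}` is the partial derivative `∂/∂xᵢ` (Mathlib's
`MvPolynomial.pderiv`). [folklore] -/
theorem dirDeriv_single [DecidableEq (Fin n)] (i : Fin n) :
    (dirDeriv (Pi.single i 1) : Derivation k (MvPolynomial (Fin n) k) _) = pderiv i :=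
  derivation_ext fun j => by
    rcases eq_or_ne j i with rfl | h
    · simp [dirDeriv_X]
    · simp [dirDeriv_X, h, pderiv_X_of_ne h]

/-- `∂_v f = Σᵢ vᵢ ∂f/∂xᵢ`. [folklore] -/
theorem dirDeriv_apply (v : Fin n → ℤ) (f : MvPolynomial (Fin n) k) :
    dirDeriv v f = ∑ i, (v i : k) • pderiv i f := by
  classical
  have hsum : ⇑(∑ i, (v i : k) • (pderiv i : Derivation k (MvPolynomial (Fin n) k) _)) =
      ∑ i, ⇑((v i : k) • (pderiv i : Derivation k (MvPolynomial (Fin n) k) _)) :=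
    map_sum (Derivation.coeFnAddMonoidHom) _ _
  have hD : dirDeriv v = ∑ i, (v i : k) • (pderiv i : Derivation k (MvPolynomial (Fin n) k) _) :=
    derivation_ext fun j => by
      rw [hsum, Finset.sum_apply]
      simp [dirDeriv_X, Pi.single_apply, smul_eq_C_mul]
  rw [hD, hsum, Finset.sum_apply]
  simp

/-- Partial derivatives of polynomials along constant vector fields commute:
`∂_v ∂_w = ∂_w ∂_v` (the bracket `[∂_v, ∂_w]` is a derivation killing every `xᵢ`). [folklore] -/
theorem dirDeriv_comm (v w : Fin n → ℤ) (f : MvPolynomial (Fin n) k) :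
    dirDeriv v (dirDeriv w f) = dirDeriv w (dirDeriv v f) := by
  have h : ⁅(dirDeriv v : Derivation k (MvPolynomial (Fin n) k) (MvPolynomial (Fin n) k)),
      (dirDeriv w : Derivation k (MvPolynomial (Fin n) k) (MvPolynomial (Fin n) k))⁆ = 0 :=
    derivation_ext fun i => by
      change dirDeriv v (dirDeriv w (X i)) - dirDeriv w (dirDeriv v (X i)) =
        (0 : Derivation k (MvPolynomial (Fin n) k) (MvPolynomial (Fin n) k)) (X i)
      simp [dirDeriv_X]
  have h' : dirDeriv v (dirDeriv w f) - dirDeriv w (dirDeriv v f) = 0 :=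
    congrArg (fun D : Derivation k (MvPolynomial (Fin n) k) (MvPolynomial (Fin n) k) => D f) h
  exact sub_eq_zero.mp h'

/-- The gradient pairing `v ↦ ∂_v f` of a polynomial, an additive map `ℤⁿ → P` (the `1`-form
`df` evaluated on constant vector fields). [folklore] -/
def grad (f : MvPolynomial (Fin n) k) : (Fin n → ℤ) →ₗ[ℤ] MvPolynomial (Fin n) k where
  toFun v := dirDeriv v f
  map_add' v w := by simp [dirDeriv_add]
  map_smul' c v := by rw [RingHom.id_apply, dirDeriv_smul, Derivation.smul_apply]

/-- `grad f v = ∂_v f`. [folklore] -/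
@[simp]
theorem grad_apply (f : MvPolynomial (Fin n) k) (v : Fin n → ℤ) : grad f v = dirDeriv v f :=
  rfl

/-! ### The exterior derivative -/

variable {p : ℕ}

/-- Differentiating the coefficients of a form along a constant vector field:
`v ↦ (∂_v ∘ ω : (u₁, …, u_p) ↦ ∂_v (ω(u₁, …, u_p)))`, additive in `v` (the "`fderiv`" of the
form, all of whose arguments are constant fields). [folklore] -/
def lieAlong (ω : PolyForm k n p) : (Fin n → ℤ) →ₗ[ℤ] PolyForm k n p where
  toFun v := (((dirDeriv v : Derivation k _ _) :
    MvPolynomial (Fin n) k →ₗ[k] MvPolynomial (Fin n) k).restrictScalars ℤ).compAlternatingMap ω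
  map_add' v w := by ext u; simp [dirDeriv_add]
  map_smul' c v := AlternatingMap.ext fun u => by
    change dirDeriv (c • v) (ω u) = c • dirDeriv v (ω u)
    rw [dirDeriv_smul, Derivation.smul_apply]

/-- `lieAlong ω v u = ∂_v (ω u)`. [folklore] -/
@[simp]
theorem lieAlong_apply (ω : PolyForm k n p) (v : Fin n → ℤ) (u : Fin p → Fin n → ℤ) :
    lieAlong ω v u = dirDeriv v (ω u) :=
  rfl

/-- `lieAlong` is additive in the form. [folklore] -/
theorem lieAlong_add (ω₁ ω₂ : PolyForm k n p) :
    lieAlong (ω₁ + ω₂) = lieAlong ω₁ + lieAlong ω₂ := by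
  ext v u; simp

/-- `lieAlong` commutes with scalars of `k`. [folklore] -/
theorem lieAlong_smul (c : k) (ω : PolyForm k n p) : lieAlong (c • ω) = c • lieAlong ω := by
  ext v u; simp

/-- `lieAlong 0 = 0`. [folklore] -/
@[simp]
theorem lieAlong_zero : lieAlong (0 : PolyForm k n p) = 0 :=
  LinearMap.ext fun v => AlternatingMap.ext fun u => by simp

/-- `lieAlong` commutes with integer scalars (it is additive). [folklore] -/
theorem lieAlong_zsmul (c : ℤ) (ω : PolyForm k n p) : lieAlong (c • ω) = c • lieAlong ω :=
  map_zsmul ({ toFun := lieAlong, map_zero' := lieAlong_zero, map_add' := lieAlong_add } :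
    PolyForm k n p →+ ((Fin n → ℤ) →ₗ[ℤ] PolyForm k n p)) c ω

/-- Leibniz rule for `lieAlong`: `∂_v ∘ (f ω) = (∂_v f) ω + f (∂_v ∘ ω)`. [folklore] -/
theorem lieAlong_polySmul (f : MvPolynomial (Fin n) k) (ω : PolyForm k n p) :
    lieAlong (f • ω) = (grad f).smulRight ω + f • lieAlong ω := by
  refine LinearMap.ext fun v => AlternatingMap.ext fun u => ?_
  simp only [lieAlong_apply, AlternatingMap.smul_apply, smul_eq_mul, Derivation.leibniz,
    LinearMap.add_apply, LinearMap.smulRight_apply, grad_apply, LinearMap.smul_apply,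
    AlternatingMap.add_apply]
  ring

/-- **The exterior derivative** `d : Ω^p_{P/k} → Ω^{p+1}_{P/k}` of polynomial forms,
`dω(v₀, …, v_p) = Σᵢ (−1)ⁱ ∂_{vᵢ} ω(v₀, …, v̂ᵢ, …, v_p)` — the invariant formula for `d`
evaluated on constant vector fields (all Lie brackets vanish), in Mathlib's normalisation of
`extDeriv`; on monomial forms `d(f dx_J) = Σᵢ ∂f/∂xᵢ dxᵢ ∧ dx_J`. [folklore] -/
def extDeriv (ω : PolyForm k n p) : PolyForm k n (p + 1) :=
  AlternatingMap.alternatizeUncurryFin (lieAlong ω)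

/-- The defining formula of `d` (sign written in `P`, `simp`-normal form):
`dω(v) = Σᵢ (−1)ⁱ ∂_{vᵢ} (ω(v₀, …, v̂ᵢ, …, v_p))`. [folklore] -/
theorem extDeriv_apply (ω : PolyForm k n p) (v : Fin (p + 1) → Fin n → ℤ) :
    extDeriv ω v = ∑ i : Fin (p + 1),
      (-1) ^ (i : ℕ) * dirDeriv (v i) (ω (i.removeNth v)) := by
  simp [extDeriv, AlternatingMap.alternatizeUncurryFin_apply]

/-- In degree `0`, `d` is the differential of functions: `(df)(v) = ∂_v f`. [folklore] -/
@[simp]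
theorem extDeriv_ofPoly_apply (f : MvPolynomial (Fin n) k) (v : Fin 1 → Fin n → ℤ) :
    extDeriv (ofPoly f) v = dirDeriv (v 0) f := by
  simp [extDeriv_apply]

/-- `d` is additive. [folklore] -/
theorem extDeriv_add (ω₁ ω₂ : PolyForm k n p) :
    extDeriv (ω₁ + ω₂) = extDeriv ω₁ + extDeriv ω₂ := by
  rw [extDeriv, lieAlong_add, AlternatingMap.alternatizeUncurryFin_add]; rfl

/-- `d` commutes with scalars of `k`. [folklore] -/
theorem extDeriv_smul_const (c : k) (ω : PolyForm k n p) :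
    extDeriv (c • ω) = c • extDeriv ω := by
  rw [extDeriv, lieAlong_smul, AlternatingMap.alternatizeUncurryFin_smul]; rfl

/-- `d 0 = 0`. [folklore] -/
@[simp]
theorem extDeriv_zero : extDeriv (0 : PolyForm k n p) = 0 := by
  simpa using extDeriv_smul_const (0 : k) (0 : PolyForm k n p)

variable (k n p) in
/-- The exterior derivative as a `k`-linear map `Ω^p_{P/k} →ₗ[k] Ω^{p+1}_{P/k}`. [folklore] -/
def extDerivₗ : PolyForm k n p →ₗ[k] PolyForm k n (p + 1) where
  toFun := extDeriv
  map_add' := extDeriv_add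
  map_smul' := extDeriv_smul_const

/-- `extDerivₗ` is `extDeriv`. [folklore] -/
@[simp]
theorem extDerivₗ_apply (ω : PolyForm k n p) : extDerivₗ k n p ω = extDeriv ω :=
  rfl

/-- The second-derivative pairing `(v, w) ↦ ∂_v ∘ ∂_w ∘ ω`, a `k`-bilinear map with values in
forms; it is symmetric (`dirDeriv_comm`), which is why `d ∘ d = 0`. [folklore] -/
def lieAlong₂ (ω : PolyForm k n p) : (Fin n → ℤ) →ₗ[ℤ] (Fin n → ℤ) →ₗ[ℤ] PolyForm k n p where
  toFun v := lieAlong (lieAlong ω v)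
  map_add' v w := by rw [map_add, lieAlong_add]
  map_smul' c v := by rw [map_smul, lieAlong_zsmul]; rfl

/-- `lieAlong₂ ω v w u = ∂_w ∂_v (ω u)`. [folklore] -/
@[simp]
theorem lieAlong₂_apply (ω : PolyForm k n p) (v w : Fin n → ℤ) (u : Fin p → Fin n → ℤ) :
    lieAlong₂ ω v w u = dirDeriv w (dirDeriv v (ω u)) :=
  rfl

/-- A derivation passes through the defining sum of `dω`:
`∂_v (dω(u)) = Σᵢ (−1)ⁱ ∂_v ∂_{uᵢ} ω(u₀, …, ûᵢ, …, u_p)`. [folklore] -/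
theorem dirDeriv_extDeriv_apply (ω : PolyForm k n p) (v : Fin n → ℤ)
    (u : Fin (p + 1) → Fin n → ℤ) :
    dirDeriv v (extDeriv ω u) = ∑ i : Fin (p + 1),
      (-1) ^ (i : ℕ) * dirDeriv v (dirDeriv (u i) (ω (i.removeNth u))) := by
  rw [extDeriv_apply, map_sum]
  refine Finset.sum_congr rfl fun i _ => ?_
  rw [Derivation.leibniz, Derivation.leibniz_pow, Derivation.map_neg,
    Derivation.map_one_eq_zero, neg_zero, smul_zero, smul_zero, smul_zero, add_zero, smul_eq_mul]

/-- Differentiating `dω` along `v` is `d` of the `v`-derivative of the coefficients: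
`∂_v ∘ dω = alternatizeUncurryFin (w ↦ ∂_v ∘ ∂_w ∘ ω)`. [folklore] -/
theorem lieAlong_extDeriv (ω : PolyForm k n p) :
    lieAlong (extDeriv ω) = AlternatingMap.alternatizeUncurryFinLM ∘ₗ (lieAlong₂ ω).flip := by
  refine LinearMap.ext fun v => AlternatingMap.ext fun u => ?_
  rw [lieAlong_apply, dirDeriv_extDeriv_apply]
  simp [AlternatingMap.alternatizeUncurryFin_apply]

/-- **`d ∘ d = 0`** on polynomial forms: the second exterior derivative vanishes, because the
second partial derivatives of a polynomial along constant fields commute (Mathlib's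
`alternatizeUncurryFin_alternatizeUncurryFinLM_comp_of_symmetric`, the algebraic shadow of
`extDeriv_extDeriv`). [folklore] -/
theorem extDeriv_extDeriv (ω : PolyForm k n p) : extDeriv (extDeriv ω) = 0 := by
  rw [extDeriv, lieAlong_extDeriv]
  exact AlternatingMap.alternatizeUncurryFin_alternatizeUncurryFinLM_comp_of_symmetric
    fun v w => AlternatingMap.ext fun u => by simp [dirDeriv_comm v w]

/-- The wedge `df ∧ ω` of the differential of a polynomial with a `p`-form:
`(df ∧ ω)(v₀, …, v_p) = Σᵢ (−1)ⁱ (∂_{vᵢ} f) ω(v₀, …, v̂ᵢ, …, v_p)`. Only this special case of the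
wedge product is needed to describe the forms vanishing on a subscheme. [folklore] -/
def dWedge (f : MvPolynomial (Fin n) k) (ω : PolyForm k n p) : PolyForm k n (p + 1) :=
  AlternatingMap.alternatizeUncurryFin ((grad f).smulRight ω)

/-- The defining formula of `df ∧ ω`. [folklore] -/
theorem dWedge_apply (f : MvPolynomial (Fin n) k) (ω : PolyForm k n p)
    (v : Fin (p + 1) → Fin n → ℤ) :
    dWedge f ω v = ∑ i : Fin (p + 1),
      (-1) ^ (i : ℕ) * (dirDeriv (v i) f * ω (i.removeNth v)) := by
  simp [dWedge, AlternatingMap.alternatizeUncurryFin_apply]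

/-- **Leibniz rule** `d(f ω) = df ∧ ω + f dω` for a polynomial `f` and a form `ω`. [folklore] -/
theorem extDeriv_smul (f : MvPolynomial (Fin n) k) (ω : PolyForm k n p) :
    extDeriv (f • ω) = dWedge f ω + f • extDeriv ω := by
  rw [extDeriv, lieAlong_polySmul, AlternatingMap.alternatizeUncurryFin_add,
    AlternatingMap.alternatizeUncurryFin_smul]
  rfl

/-- `d(df ∧ ω) = −df ∧ dω` (apply `d ∘ d = 0` to `f ω` and to `ω`). [folklore] -/
theorem extDeriv_dWedge (f : MvPolynomial (Fin n) k) (ω : PolyForm k n p) :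
    extDeriv (dWedge f ω) = -dWedge f (extDeriv ω) := by
  have h := extDeriv_extDeriv (f • ω)
  rw [extDeriv_smul, extDeriv_add, extDeriv_smul, extDeriv_extDeriv, smul_zero, add_zero] at h
  exact eq_neg_of_add_eq_zero_left h

/-- `df ∧ 0 = 0`. [folklore] -/
@[simp]
theorem dWedge_zero (f : MvPolynomial (Fin n) k) : dWedge f (0 : PolyForm k n p) = 0 := by
  refine AlternatingMap.ext fun v => ?_
  simp [dWedge_apply]

/-- `df ∧ (ω₁ + ω₂) = df ∧ ω₁ + df ∧ ω₂`. [folklore] -/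
theorem dWedge_add (f : MvPolynomial (Fin n) k) (ω₁ ω₂ : PolyForm k n p) :
    dWedge f (ω₁ + ω₂) = dWedge f ω₁ + dWedge f ω₂ := by
  refine AlternatingMap.ext fun v => ?_
  simp [dWedge_apply, mul_add, Finset.sum_add_distrib]

/-- `df ∧ (g ω) = g (df ∧ ω)` (`P`-linearity in the form). [folklore] -/
theorem dWedge_smul_right (f g : MvPolynomial (Fin n) k) (ω : PolyForm k n p) :
    dWedge f (g • ω) = g • dWedge f ω := by
  refine AlternatingMap.ext fun v => ?_
  simp only [dWedge_apply, AlternatingMap.smul_apply, smul_eq_mul, Finset.mul_sum]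
  exact Finset.sum_congr rfl fun i _ => by ring

/-- `d(fg) ∧ η = f (dg ∧ η) + g (df ∧ η)` (Leibniz rule for the gradient). [folklore] -/
theorem dWedge_mul (f g : MvPolynomial (Fin n) k) (η : PolyForm k n p) :
    dWedge (f * g) η = f • dWedge g η + g • dWedge f η := by
  refine AlternatingMap.ext fun v => ?_
  simp only [dWedge_apply, AlternatingMap.add_apply, AlternatingMap.smul_apply, smul_eq_mul,
    Finset.mul_sum, ← Finset.sum_add_distrib, Derivation.leibniz]
  exact Finset.sum_congr rfl fun i _ => by ring

/-- **Anticommutativity** `df ∧ (dg ∧ η) + dg ∧ (df ∧ η) = 0`, obtained from `d ∘ d = 0` applied to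
`(fg) η` together with the Leibniz rules (no sign bookkeeping needed). [folklore] -/
theorem dWedge_dWedge_add (f g : MvPolynomial (Fin n) k) (η : PolyForm k n p) :
    dWedge f (dWedge g η) + dWedge g (dWedge f η) = 0 := by
  have h := extDeriv_extDeriv ((f * g) • η)
  rw [extDeriv_smul, dWedge_mul, extDeriv_add, extDeriv_add, extDeriv_smul, extDeriv_smul,
    extDeriv_smul, extDeriv_dWedge, extDeriv_dWedge, extDeriv_extDeriv, dWedge_mul, smul_zero,
    add_zero, smul_neg, smul_neg] at h
  rw [← h]
  abel

/-- `df ∧ (dg ∧ η) = −dg ∧ (df ∧ η)`. [folklore] -/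
theorem dWedge_dWedge (f g : MvPolynomial (Fin n) k) (η : PolyForm k n p) :
    dWedge f (dWedge g η) = -dWedge g (dWedge f η) :=
  eq_neg_of_add_eq_zero_left (dWedge_dWedge_add f g η)

/-! ### Forms vanishing on the closed subscheme `V(I)` and regular forms on it -/

variable (I : Ideal (MvPolynomial (Fin n) k))

/-- The polynomial `p`-forms on `𝔸ⁿ_k` that **vanish on the closed subscheme `X = V(I)`**: the
degree-`p` part of the differential graded ideal of `Ω^•_{P/k}` generated by `I`,
`I·Ω^p + dI ∧ Ω^{p-1}` — the kernel of `Ω^p_{P/k} → Ω^p_{A/k}`, `A = P/I` (conormal sequence and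
`⋀^p(M/N) = ⋀^p M/(N ∧ ⋀^{p-1}M)`: Hartshorne, *Algebraic Geometry* II.8.4A for the conormal
sequence, Bourbaki, *Algèbre* III §7 no. 2 for exterior powers of a quotient).
Defined by recursion on the degree, without the wedge product: `I·Ω⁰ = I` in degree `0`, and
`I·Ω^{p+1} + P·d(vanishingForms I p)` in degree `p + 1`; the agreement with the printed
description is `vanishingForms_eq_dgIdealSpan` / `vanishingForms_succ`. [folklore] -/
def vanishingForms : (p : ℕ) → Submodule (MvPolynomial (Fin n) k) (PolyForm k n p)
  | 0 => I • ⊤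
  | p + 1 => I • ⊤ ⊔ Submodule.span (MvPolynomial (Fin n) k)
      (extDeriv '' (vanishingForms p : Set (PolyForm k n p)))

/-- `I·Ω^p` vanishes on `V(I)`. [folklore] -/
theorem smul_top_le_vanishingForms (p : ℕ) : I • ⊤ ≤ vanishingForms I p := by
  cases p with
  | zero => exact le_rfl
  | succ p => exact le_sup_left

/-- `f ω` vanishes on `V(I)` for `f ∈ I`. [folklore] -/
theorem smul_mem_vanishingForms {f : MvPolynomial (Fin n) k} (hf : f ∈ I) (ω : PolyForm k n p) :
    f • ω ∈ vanishingForms I p :=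
  smul_top_le_vanishingForms I p (Submodule.smul_mem_smul hf Submodule.mem_top)

/-- The forms vanishing on `V(I)` are stable under `d`. [folklore] -/
theorem extDeriv_mem_vanishingForms {ω : PolyForm k n p} (h : ω ∈ vanishingForms I p) :
    extDeriv ω ∈ vanishingForms I (p + 1) :=
  Submodule.mem_sup_right (Submodule.subset_span ⟨ω, h, rfl⟩)

/-- `df ∧ ω` vanishes on `V(I)` for `f ∈ I` (it is `d(f ω) − f dω`). [folklore] -/
theorem dWedge_mem_vanishingForms {f : MvPolynomial (Fin n) k} (hf : f ∈ I) (ω : PolyForm k n p) :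
    dWedge f ω ∈ vanishingForms I (p + 1) := by
  have h : dWedge f ω = extDeriv (f • ω) - f • extDeriv ω := by rw [extDeriv_smul]; abel
  rw [h]
  exact Submodule.sub_mem _ (extDeriv_mem_vanishingForms I (smul_mem_vanishingForms I hf ω))
    (smul_mem_vanishingForms I hf _)

/-- **Minimality**: `vanishingForms I` is the smallest family of `P`-submodules of `Ω^•_{P/k}`
containing `I·Ω^•` and stable under `d` — i.e. the differential graded ideal generated by `I`.
[folklore] -/
theorem vanishingForms_le {N : (p : ℕ) → Submodule (MvPolynomial (Fin n) k) (PolyForm k n p)}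
    (h0 : ∀ p, I • ⊤ ≤ N p) (hd : ∀ p (ω : PolyForm k n p), ω ∈ N p → extDeriv ω ∈ N (p + 1)) :
    ∀ p, vanishingForms I p ≤ N p
  | 0 => h0 0
  | p + 1 => sup_le (h0 (p + 1)) (Submodule.span_le.mpr <| by
      rintro _ ⟨ω, hω, rfl⟩
      exact hd p ω (vanishingForms_le h0 hd p hω))

/-- `vanishingForms` is monotone in the ideal. [folklore] -/
theorem vanishingForms_mono {I J : Ideal (MvPolynomial (Fin n) k)} (h : I ≤ J) :
    ∀ p, vanishingForms I p ≤ vanishingForms J p :=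
  vanishingForms_le I (fun p => (Submodule.smul_mono_left h).trans (smul_top_le_vanishingForms J p))
    fun _ _ hω => extDeriv_mem_vanishingForms J hω

/-- On all of affine space (`I = 0`) no non-zero form vanishes. [folklore] -/
theorem vanishingForms_bot (p : ℕ) : vanishingForms (⊥ : Ideal (MvPolynomial (Fin n) k)) p = ⊥ := by
  refine le_bot_iff.mp (vanishingForms_le (⊥ : Ideal (MvPolynomial (Fin n) k))
    (N := fun p => (⊥ : Submodule (MvPolynomial (Fin n) k) (PolyForm k n p)))
    (fun _ => by simp) (fun _ ω hω => ?_) p)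
  rw [(Submodule.mem_bot _).mp hω, extDeriv_zero]
  exact Submodule.zero_mem _

/-- In degree `0` the forms vanishing on `V(I)` are exactly (the `0`-forms of) `I`. [folklore] -/
theorem ofPoly_mem_vanishingForms_iff (f : MvPolynomial (Fin n) k) :
    ofPoly f ∈ vanishingForms I 0 ↔ f ∈ I := by
  constructor
  · intro h
    suffices H : ∀ ω ∈ vanishingForms I 0, ω 0 ∈ I from H _ h
    intro ω hω
    simp only [vanishingForms] at hω
    refine Submodule.smul_induction_on hω (fun g hg η _ => ?_) (fun ω₁ ω₂ h₁ h₂ => ?_)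
    · simpa using I.mul_mem_right (η 0) hg
    · simpa using I.add_mem h₁ h₂
  · intro hf
    have : ofPoly f = f • ofPoly (1 : MvPolynomial (Fin n) k) := by
      rw [← map_smul, smul_eq_mul, mul_one]
    rw [this]
    exact smul_mem_vanishingForms I hf _

/-- The printed description of the forms vanishing on `V(I)`: `I·Ω⁰ = I` and, in degree
`p + 1`, `I·Ω^{p+1} + dI ∧ Ω^p` — the `P`-span of the forms `f ω` and `df ∧ η` with `f ∈ I`.
It coincides with `vanishingForms I` (`vanishingForms_eq_dgIdealSpan`). [folklore] -/
def dgIdealSpan : (p : ℕ) → Submodule (MvPolynomial (Fin n) k) (PolyForm k n p)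
  | 0 => I • ⊤
  | p + 1 => I • ⊤ ⊔ Submodule.span (MvPolynomial (Fin n) k)
      {θ | ∃ f ∈ I, ∃ η : PolyForm k n p, dWedge f η = θ}

/-- `I·Ω^p ≤ I·Ω^p + dI ∧ Ω^{p-1}`. [folklore] -/
theorem smul_top_le_dgIdealSpan : ∀ p, I • ⊤ ≤ dgIdealSpan I p
  | 0 => le_rfl
  | _ + 1 => le_sup_left

/-- `df ∧ η ∈ I·Ω^{p+1} + dI ∧ Ω^p` for `f ∈ I`. [folklore] -/
theorem dWedge_mem_dgIdealSpan {f : MvPolynomial (Fin n) k} (hf : f ∈ I) (η : PolyForm k n p) :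
    dWedge f η ∈ dgIdealSpan I (p + 1) :=
  Submodule.mem_sup_right (Submodule.subset_span ⟨f, hf, η, rfl⟩)

/-- The printed description is contained in `vanishingForms`. [folklore] -/
theorem dgIdealSpan_le_vanishingForms : ∀ p, dgIdealSpan I p ≤ vanishingForms I p
  | 0 => le_rfl
  | p + 1 => sup_le (smul_top_le_vanishingForms I (p + 1)) (Submodule.span_le.mpr <| by
      rintro _ ⟨f, hf, η, rfl⟩
      exact dWedge_mem_vanishingForms I hf η)

/-- `dg ∧ θ ∈ I·Ω + dI ∧ Ω` whenever `θ ∈ I·Ω` (for any polynomial `g`). [folklore] -/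
theorem dWedge_mem_dgIdealSpan_of_mem_smul_top (g : MvPolynomial (Fin n) k) {θ : PolyForm k n p}
    (hθ : θ ∈ I • (⊤ : Submodule (MvPolynomial (Fin n) k) (PolyForm k n p))) :
    dWedge g θ ∈ dgIdealSpan I (p + 1) := by
  refine Submodule.smul_induction_on hθ (fun f hf η _ => ?_) (fun θ₁ θ₂ h₁ h₂ => ?_)
  · rw [dWedge_smul_right]
    exact smul_top_le_dgIdealSpan I _ (Submodule.smul_mem_smul hf Submodule.mem_top)
  · rw [dWedge_add]
    exact Submodule.add_mem _ h₁ h₂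

/-- The printed description is stable under `θ ↦ dg ∧ θ` for every polynomial `g`. [folklore] -/
theorem dWedge_mem_dgIdealSpan_of_mem (g : MvPolynomial (Fin n) k) :
    ∀ {p : ℕ} {θ : PolyForm k n p}, θ ∈ dgIdealSpan I p → dWedge g θ ∈ dgIdealSpan I (p + 1)
  | 0, _, hθ => dWedge_mem_dgIdealSpan_of_mem_smul_top I g hθ
  | p + 1, θ, hθ => by
    obtain ⟨a, ha, b, hb, rfl⟩ := Submodule.mem_sup.mp hθ
    rw [dWedge_add]
    refine Submodule.add_mem _ (dWedge_mem_dgIdealSpan_of_mem_smul_top I g ha) ?_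
    clear hθ
    induction hb using Submodule.span_induction with
    | mem θ hθ =>
      obtain ⟨f, hf, η, rfl⟩ := hθ
      rw [dWedge_dWedge]
      exact Submodule.neg_mem _ (dWedge_mem_dgIdealSpan I hf _)
    | zero => rw [dWedge_zero]; exact Submodule.zero_mem _
    | add θ₁ θ₂ _ _ h₁ h₂ => rw [dWedge_add]; exact Submodule.add_mem _ h₁ h₂
    | smul h θ _ hθ => rw [dWedge_smul_right]; exact Submodule.smul_mem _ h hθ

/-- `dθ ∈ I·Ω + dI ∧ Ω` whenever `θ ∈ I·Ω`. [folklore] -/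
theorem extDeriv_mem_dgIdealSpan_of_mem_smul_top {θ : PolyForm k n p}
    (hθ : θ ∈ I • (⊤ : Submodule (MvPolynomial (Fin n) k) (PolyForm k n p))) :
    extDeriv θ ∈ dgIdealSpan I (p + 1) := by
  refine Submodule.smul_induction_on hθ (fun f hf η _ => ?_) (fun θ₁ θ₂ h₁ h₂ => ?_)
  · rw [extDeriv_smul]
    exact Submodule.add_mem _ (dWedge_mem_dgIdealSpan I hf η)
      (smul_top_le_dgIdealSpan I _ (Submodule.smul_mem_smul hf Submodule.mem_top))
  · rw [extDeriv_add]
    exact Submodule.add_mem _ h₁ h₂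

/-- The printed description is stable under `d`. [folklore] -/
theorem extDeriv_mem_dgIdealSpan_of_mem :
    ∀ {p : ℕ} {θ : PolyForm k n p}, θ ∈ dgIdealSpan I p → extDeriv θ ∈ dgIdealSpan I (p + 1)
  | 0, _, hθ => extDeriv_mem_dgIdealSpan_of_mem_smul_top I hθ
  | p + 1, θ, hθ => by
    obtain ⟨a, ha, b, hb, rfl⟩ := Submodule.mem_sup.mp hθ
    rw [extDeriv_add]
    refine Submodule.add_mem _ (extDeriv_mem_dgIdealSpan_of_mem_smul_top I ha) ?_
    clear hθ
    induction hb using Submodule.span_induction with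
    | mem θ hθ =>
      obtain ⟨f, hf, η, rfl⟩ := hθ
      rw [extDeriv_dWedge]
      exact Submodule.neg_mem _ (dWedge_mem_dgIdealSpan I hf _)
    | zero => rw [extDeriv_zero]; exact Submodule.zero_mem _
    | add θ₁ θ₂ _ _ h₁ h₂ => rw [extDeriv_add]; exact Submodule.add_mem _ h₁ h₂
    | smul h θ hθ ih =>
      rw [extDeriv_smul]
      exact Submodule.add_mem _
        (dWedge_mem_dgIdealSpan_of_mem I h (Submodule.mem_sup_right hθ))
        (Submodule.smul_mem _ h ih)

/-- **The two descriptions agree**: the recursively defined `vanishingForms I p` is exactly the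
printed `I·Ω^p + dI ∧ Ω^{p-1}` (differential graded ideal generated by `I`, degree `p`).
[folklore] -/
theorem vanishingForms_eq_dgIdealSpan (p : ℕ) : vanishingForms I p = dgIdealSpan I p :=
  le_antisymm
    (vanishingForms_le I (N := dgIdealSpan I) (smul_top_le_dgIdealSpan I)
      (fun _ _ hω => extDeriv_mem_dgIdealSpan_of_mem I hω) p)
    (dgIdealSpan_le_vanishingForms I p)

/-- In positive degree: `vanishingForms I (p+1) = I·Ω^{p+1} + P·{df ∧ η | f ∈ I}`. [folklore] -/
theorem vanishingForms_succ (p : ℕ) :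
    vanishingForms I (p + 1) = I • ⊤ ⊔ Submodule.span (MvPolynomial (Fin n) k)
      {θ | ∃ f ∈ I, ∃ η : PolyForm k n p, dWedge f η = θ} :=
  vanishingForms_eq_dgIdealSpan I (p + 1)

/-! ### Base change of the coefficient ring -/

section BaseChange

variable {k' : Type*} [CommRing k'] (φ : k →+* k')

/-- A ring map commutes with the directional derivatives along integer vector fields:
`φ(∂_v f) = ∂_v (φ f)` (coefficientwise). [folklore] -/
theorem map_dirDeriv (v : Fin n → ℤ) (f : MvPolynomial (Fin n) k) :
    MvPolynomial.map φ (dirDeriv v f) = dirDeriv v (MvPolynomial.map φ f) := by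
  rw [dirDeriv_apply, dirDeriv_apply, map_sum]
  refine Finset.sum_congr rfl fun i _ => ?_
  rw [smul_eq_C_mul, smul_eq_C_mul, map_mul, map_C, map_intCast, pderiv_map]

variable (n p) in
/-- **Base change of polynomial forms** along a ring map `φ : k → k'`: apply `φ` to the
coefficients, `(φ_* ω)(v₁, …, v_p) = φ(ω(v₁, …, v_p))` (the arguments, integer vector fields, do
not change). It is semilinear over `φ : k[x] → k'[x]`: `φ_*(f ω) = φ(f) φ_* ω`. For `k ⊆ ℂ` this is
the complexification `Ω^p_{P_k/k} → Ω^p_{P_ℂ/ℂ} = Ω^p_{P_k/k} ⊗_k ℂ`. [folklore] -/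
def PolyForm.map : PolyForm k n p →ₛₗ[(MvPolynomial.map φ :
    MvPolynomial (Fin n) k →+* MvPolynomial (Fin n) k')] PolyForm k' n p where
  toFun ω := ((MvPolynomial.map φ : MvPolynomial (Fin n) k →+* MvPolynomial (Fin n) k')
    |>.toAddMonoidHom.toIntLinearMap).compAlternatingMap ω
  map_add' _ _ := AlternatingMap.ext fun _ => by simp
  map_smul' _ _ := AlternatingMap.ext fun _ => by simp

/-- `(φ_* ω)(v) = φ(ω(v))`. [folklore] -/
@[simp]
theorem PolyForm.map_apply (ω : PolyForm k n p) (v : Fin p → Fin n → ℤ) :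
    PolyForm.map n p φ ω v = MvPolynomial.map φ (ω v) :=
  rfl

/-- Base change commutes with the exterior derivative: `φ_*(dω) = d(φ_* ω)`. [folklore] -/
theorem PolyForm.map_extDeriv (ω : PolyForm k n p) :
    PolyForm.map n (p + 1) φ (extDeriv ω) = extDeriv (PolyForm.map n p φ ω) := by
  refine AlternatingMap.ext fun v => ?_
  simp [extDeriv_apply, map_sum, map_dirDeriv]

/-- Base change commutes with `f ↦ df ∧ ·`: `φ_*(df ∧ ω) = d(φ f) ∧ φ_* ω`. [folklore] -/
theorem PolyForm.map_dWedge (f : MvPolynomial (Fin n) k) (ω : PolyForm k n p) :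
    PolyForm.map n (p + 1) φ (dWedge f ω) = dWedge (MvPolynomial.map φ f) (PolyForm.map n p φ ω) := by
  refine AlternatingMap.ext fun v => ?_
  simp [dWedge_apply, map_sum, map_dirDeriv]

/-- Base change maps the forms vanishing on `V(I)` to forms vanishing on `V(I k'[x])` (the base
change of the subscheme). [folklore] -/
theorem PolyForm.map_mem_vanishingForms {ω : PolyForm k n p} (h : ω ∈ vanishingForms I p) :
    PolyForm.map n p φ ω ∈ vanishingForms (I.map (MvPolynomial.map φ)) p := by
  refine vanishingForms_le I
    (N := fun q => (vanishingForms (I.map (MvPolynomial.map φ)) q).comap (PolyForm.map n q φ))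
    (fun q => Submodule.smul_le.mpr fun f hf ω _ => ?_) (fun q ω hω => ?_) p h
  · rw [Submodule.mem_comap, LinearMap.map_smulₛₗ]
    exact smul_mem_vanishingForms _ (Ideal.mem_map_of_mem _ hf) _
  · rw [Submodule.mem_comap, PolyForm.map_extDeriv]
    exact extDeriv_mem_vanishingForms _ hω

end BaseChange

/-- **Regular (Kähler) `p`-forms on the closed subscheme `X = V(I) ⊆ 𝔸ⁿ_k`**, i.e. the global
sections `Γ(X, Ω^p_{X/k}) = Ω^p_{A/k} = ⋀^p_A Ω_{A/k}` for `A = P/I`: polynomial `p`-forms on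
affine space modulo those vanishing on `X`. A module over `P` and over `k`.
Grothendieck's "differential forms on `X` which are rational and everywhere defined".
[cite: Grothendieck1966, Thm 1] -/
def RegularForm (p : ℕ) : Type _ :=
  PolyForm k n p ⧸ vanishingForms I p

namespace RegularForm

/-- The additive group of regular forms (quotient structure). [folklore] -/
instance instAddCommGroup : AddCommGroup (RegularForm I p) :=
  Submodule.Quotient.addCommGroup _

/-- Regular forms are a `P`-module (quotient structure). [folklore] -/
instance instModulePoly : Module (MvPolynomial (Fin n) k) (RegularForm I p) :=
  Submodule.Quotient.module _

/-- Regular forms are a `k`-module (quotient structure, restricted scalars). [folklore] -/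
instance instModule : Module k (RegularForm I p) :=
  Submodule.Quotient.module' _

/-- The two module structures on regular forms are compatible. [folklore] -/
instance instIsScalarTower :
    IsScalarTower k (MvPolynomial (Fin n) k) (RegularForm I p) :=
  Submodule.Quotient.isScalarTower _ _

/-- Restriction to `X`: the class of a polynomial form as a regular form on `V(I)`. [folklore] -/
def mk : PolyForm k n p →ₗ[MvPolynomial (Fin n) k] RegularForm I p :=
  (vanishingForms I p).mkQ

/-- Every regular form on `X` is the restriction of a polynomial form on affine space (by
definition here; for the sheaf `Ω^p_X` this is the surjectivity of `Ω^p_P → Ω^p_A`). [folklore] -/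
theorem mk_surjective : Function.Surjective (mk I (p := p)) :=
  Submodule.mkQ_surjective _

/-- Two polynomial forms restrict to the same regular form iff their difference vanishes on `X`.
[folklore] -/
theorem mk_eq_mk_iff (ω₁ ω₂ : PolyForm k n p) :
    mk I ω₁ = mk I ω₂ ↔ ω₁ - ω₂ ∈ vanishingForms I p :=
  Submodule.Quotient.eq _

/-- A polynomial form restricts to zero iff it vanishes on `X`. [folklore] -/
theorem mk_eq_zero_iff (ω : PolyForm k n p) : mk I ω = 0 ↔ ω ∈ vanishingForms I p :=
  Submodule.Quotient.mk_eq_zero _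

/-- The differential `d : Ω^p_{A/k} → Ω^{p+1}_{A/k}` of regular forms on `X = V(I)`, induced by
`extDeriv` (which preserves the forms vanishing on `X`); `k`-linear. [folklore] -/
def d : RegularForm I p →ₗ[k] RegularForm I (p + 1) :=
  ((vanishingForms I p).restrictScalars k).liftQ
      (((vanishingForms I (p + 1)).mkQ.restrictScalars k) ∘ₗ extDerivₗ k n p)
      (fun _ hω => (Submodule.Quotient.mk_eq_zero _).mpr (extDeriv_mem_vanishingForms I hω)) ∘ₗ
    (Submodule.Quotient.restrictScalarsEquiv k (vanishingForms I p)).symm.toLinearMap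

/-- `d` of the restriction of `ω` is the restriction of `dω`. [folklore] -/
@[simp]
theorem d_mk (ω : PolyForm k n p) : d I (mk I ω) = mk I (extDeriv ω) :=
  rfl

/-- `d ∘ d = 0` on regular forms. [folklore] -/
@[simp]
theorem d_d (x : RegularForm I p) : d I (d I x) = 0 := by
  obtain ⟨ω, rfl⟩ := mk_surjective I x
  simp [extDeriv_extDeriv]

end RegularForm

/-- Closed regular `p`-forms on `X = V(I)`: `Z^p = ker (d : Ω^p_{A/k} → Ω^{p+1}_{A/k})`. [folklore] -/
def closedForms (p : ℕ) : Submodule k (RegularForm I p) :=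
  LinearMap.ker (RegularForm.d I (p := p))

/-- Exact regular `p`-forms on `X = V(I)`: `B⁰ = 0` and `B^{p+1} = im (d : Ω^p → Ω^{p+1})`
(pattern matching on the degree avoids `p - 1`). [folklore] -/
def exactForms : (p : ℕ) → Submodule k (RegularForm I p)
  | 0 => ⊥
  | p + 1 => LinearMap.range (RegularForm.d I (p := p))

/-- Exact forms are closed (`d ∘ d = 0`). [folklore] -/
theorem exactForms_le_closedForms : ∀ p, exactForms I p ≤ closedForms I p
  | 0 => bot_le
  | _ + 1 => by
    rintro _ ⟨x, rfl⟩
    simp [closedForms]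

/-- **Algebraic de Rham cohomology** `H^p_dR(X/k) = Z^p/B^p = H^p(Γ(X, Ω^•_{X/k}))` of the affine
`k`-scheme `X = V(I) = Spec (k[x₁, …, xₙ]/I)`: for affine `X` the hypercohomology
`ℍ^p(X, Ω^•_{X/k})` is the cohomology of the complex of global forms [Grothendieck 1966, (4);
Hartshorne 1975, Ch. II §1]. A `k`-module. [cite: Grothendieck1966, eq. (4)] -/
def DeRhamCohomology (p : ℕ) : Type _ :=
  ↥(closedForms I p) ⧸ (exactForms I p).comap (closedForms I p).subtype

namespace DeRhamCohomology

/-- The additive group structure on `H^p_dR(X/k)` (quotient structure). [folklore] -/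
instance instAddCommGroup : AddCommGroup (DeRhamCohomology I p) :=
  Submodule.Quotient.addCommGroup _

/-- The `k`-module structure on `H^p_dR(X/k)` (quotient structure). [folklore] -/
instance instModule : Module k (DeRhamCohomology I p) :=
  Submodule.Quotient.module _

/-- The cohomology class of a closed regular form. [folklore] -/
def mk : closedForms I p →ₗ[k] DeRhamCohomology I p :=
  Submodule.mkQ _

/-- Every class is represented by a closed regular form. [folklore] -/
theorem mk_surjective : Function.Surjective (mk I (p := p)) :=
  Submodule.mkQ_surjective _

/-- A closed form has zero class iff it is exact. [folklore] -/
theorem mk_eq_zero_iff (x : closedForms I p) :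
    mk I x = 0 ↔ (x : RegularForm I p) ∈ exactForms I p :=
  (Submodule.Quotient.mk_eq_zero _).trans Iff.rfl

end DeRhamCohomology

/-! ### Representative-level predicates (the computational interface) -/

/-- A polynomial `p`-form `ω` on affine space is **closed on `X = V(I)`** if `dω` vanishes on `X`,
i.e. its restriction to `X` is a closed regular form. [folklore] -/
def IsClosedOn (ω : PolyForm k n p) : Prop :=
  extDeriv ω ∈ vanishingForms I (p + 1)

/-- A polynomial form `ω` is **exact on `X = V(I)`**: in degree `0`, `ω` vanishes on `X`; in
degree `p + 1`, `ω − dη` vanishes on `X` for some polynomial `p`-form `η` (a *polynomial*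
primitive on `X`). [folklore] -/
def IsExactOn : {p : ℕ} → PolyForm k n p → Prop
  | 0, ω => ω ∈ vanishingForms I 0
  | p + 1, ω => ∃ η : PolyForm k n p, ω - extDeriv η ∈ vanishingForms I (p + 1)

/-- Unfolding `IsExactOn` in positive degree. [folklore] -/
theorem isExactOn_succ_iff (ω : PolyForm k n (p + 1)) :
    IsExactOn I ω ↔ ∃ η : PolyForm k n p, ω - extDeriv η ∈ vanishingForms I (p + 1) :=
  Iff.rfl

/-- The restriction of `ω` to `X` is a closed regular form iff `ω` is closed on `X`. [folklore] -/
theorem mk_mem_closedForms_iff (ω : PolyForm k n p) :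
    RegularForm.mk I ω ∈ closedForms I p ↔ IsClosedOn I ω := by
  simp [closedForms, IsClosedOn, RegularForm.mk_eq_zero_iff]

/-- The restriction of `ω` to `X` is an exact regular form iff `ω` is exact on `X`. [folklore] -/
theorem mk_mem_exactForms_iff : ∀ {p : ℕ} (ω : PolyForm k n p),
    RegularForm.mk I ω ∈ exactForms I p ↔ IsExactOn I ω
  | 0, ω => by simp [exactForms, IsExactOn, RegularForm.mk_eq_zero_iff]
  | p + 1, ω => by
    constructor
    · rintro ⟨x, hx⟩
      obtain ⟨η, rfl⟩ := RegularForm.mk_surjective I x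
      rw [RegularForm.d_mk, RegularForm.mk_eq_mk_iff] at hx
      exact ⟨η, by simpa using (vanishingForms I (p + 1)).neg_mem hx⟩
    · rintro ⟨η, hη⟩
      exact ⟨RegularForm.mk I η, by
        rw [RegularForm.d_mk, RegularForm.mk_eq_mk_iff]
        simpa using (vanishingForms I (p + 1)).neg_mem hη⟩

/-- Exact on `X` implies closed on `X`. [folklore] -/
theorem IsExactOn.isClosedOn : ∀ {p : ℕ} {ω : PolyForm k n p}, IsExactOn I ω → IsClosedOn I ω
  | _, ω, h => (mk_mem_closedForms_iff I ω).mp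
      (exactForms_le_closedForms I _ ((mk_mem_exactForms_iff I ω).mpr h))

/-- If `H^p_dR(X/k) = 0` then every form closed on `X` is exact on `X`. [folklore] -/
theorem isExactOn_of_subsingleton_deRhamCohomology [Subsingleton (DeRhamCohomology I p)]
    {ω : PolyForm k n p} (hω : IsClosedOn I ω) : IsExactOn I ω := by
  rw [← mk_mem_exactForms_iff]
  rw [← mk_mem_closedForms_iff] at hω
  exact (DeRhamCohomology.mk_eq_zero_iff I ⟨_, hω⟩).mp (Subsingleton.elim _ _)

/-- Closedness on `X` is preserved by base change of the coefficient ring. [folklore] -/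
theorem IsClosedOn.map {k' : Type*} [CommRing k'] (φ : k →+* k') {ω : PolyForm k n p}
    (h : IsClosedOn I ω) : IsClosedOn (I.map (MvPolynomial.map φ)) (PolyForm.map n p φ ω) := by
  unfold IsClosedOn
  rw [← PolyForm.map_extDeriv]
  exact PolyForm.map_mem_vanishingForms I φ h

/-- Exactness on `X` is preserved by base change of the coefficient ring (a `k`-primitive is a
`k'`-primitive); the converse for a field extension is the descent statement. [folklore] -/
theorem IsExactOn.map {k' : Type*} [CommRing k'] (φ : k →+* k') :
    ∀ {p : ℕ} {ω : PolyForm k n p}, IsExactOn I ω →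
      IsExactOn (I.map (MvPolynomial.map φ)) (PolyForm.map n p φ ω)
  | 0, _, h => PolyForm.map_mem_vanishingForms I φ h
  | p + 1, _, ⟨η, hη⟩ => ⟨PolyForm.map n p φ η, by
      rw [← PolyForm.map_extDeriv, ← map_sub]
      exact PolyForm.map_mem_vanishingForms I φ hη⟩

end AffineDeRham

/-! ### Grothendieck's comparison theorem, affine case (named fact) -/

open AffineDeRham Literature.AlgebraicTopology.SingularHomology in
/-- **Grothendieck's algebraic de Rham theorem for smooth affine varieties over `ℂ`** (named fact,
D-0014). *"Let `X` be an affine algebraic scheme over the field `ℂ` of complex numbers; assume `X`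
regular (i.e. "non singular"). Then the complex cohomology `H^•(X, ℂ)` can be calculated as the
cohomology of the algebraic De Rham complex (i.e. the complex of differential forms on `X` which
are "rational and everywhere defined")"* [Grothendieck 1966, Thm 1]; by loc. cit. (4) that
complex is `Γ(X, Ω^•_{X/ℂ})`, and Thm 1′ ibid. makes "calculated as" precise: the canonical map
(5) into `H^•(X^h, ℂ)` is an isomorphism (generalised in [Hartshorne 1975, Ch. IV Thm 1.1]).
Vendored form: for every ideal `I ⊆ ℂ[x₁, …, xₙ]` with `ℂ[x]/I` smooth over `ℂ` (Mathlib's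
`Algebra.Smooth`; over `ℂ`, smooth = regular for schemes of finite type) and every `p`, the
algebraic de Rham cohomology `H^p_dR(X/ℂ)` of `X = V(I)` (`AffineDeRham.DeRhamCohomology I p`) is
`ℂ`-linearly isomorphic to the singular cohomology `H^p(X(ℂ); ℂ)` of the space of complex points
`X(ℂ) = MvPolynomial.zeroLocus ℂ I ⊆ ℂⁿ` with its analytic (subspace) topology
(`Literature.AlgebraicTopology.SingularHomology.singularCohomology`). Only the EXISTENCE of an
isomorphism is asserted (the tree has no de Rham comparison map); this is implied by the printed
theorem. [cite: Grothendieck1966, Thm 1] -/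
def AffineAlgebraicDeRham : Prop :=
  ∀ (n : ℕ) (I : Ideal (MvPolynomial (Fin n) ℂ)),
    Algebra.Smooth ℂ (MvPolynomial (Fin n) ℂ ⧸ I) →
      ∀ p : ℕ, Nonempty (DeRhamCohomology I p ≃ₗ[ℂ]
        singularCohomology ℂ ℂ (MvPolynomial.zeroLocus ℂ I) p)

namespace AffineAlgebraicDeRham

open AffineDeRham Literature.AlgebraicTopology.SingularHomology

/-- Under Grothendieck's theorem, if `H^p(X(ℂ); ℂ) = 0` then `H^p_dR(X/ℂ) = 0` for the smooth
affine `X = V(I)`. [cite: Grothendieck1966, Thm 1] -/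
theorem subsingleton_deRhamCohomology (h : AffineAlgebraicDeRham) {n : ℕ}
    (I : Ideal (MvPolynomial (Fin n) ℂ)) [Algebra.Smooth ℂ (MvPolynomial (Fin n) ℂ ⧸ I)] (p : ℕ)
    [Subsingleton (singularCohomology ℂ ℂ (MvPolynomial.zeroLocus ℂ I) p)] :
    Subsingleton (DeRhamCohomology I p) :=
  (h n I ‹_› p).some.toEquiv.subsingleton

/-- **Polynomial primitives on smooth affine varieties with vanishing Betti cohomology** (the use
the requester makes of Grothendieck's theorem): if `X = V(I) ⊆ 𝔸ⁿ_ℂ` is smooth and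
`H^p(X(ℂ); ℂ) = 0`, then every polynomial `p`-form closed on `X` is exact on `X` — in positive
degree, `ω − dη` vanishes on `X` for a POLYNOMIAL form `η`. Instances: `H¹ = H² = 0` for the
affine quadric `Σ zᵢ² = 1` in `𝔸⁴_ℂ` (homotopy equivalent to `S³`), `H¹ = 0` for the quadric
surface in `𝔸³_ℂ`. [cite: Grothendieck1966, Thm 1] -/
theorem isExactOn_of_subsingleton (h : AffineAlgebraicDeRham) {n : ℕ}
    {I : Ideal (MvPolynomial (Fin n) ℂ)} [Algebra.Smooth ℂ (MvPolynomial (Fin n) ℂ ⧸ I)] {p : ℕ}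
    [Subsingleton (singularCohomology ℂ ℂ (MvPolynomial.zeroLocus ℂ I) p)]
    {ω : PolyForm ℂ n p} (hω : IsClosedOn I ω) : IsExactOn I ω :=
  haveI := subsingleton_deRhamCohomology h I p
  isExactOn_of_subsingleton_deRhamCohomology I hω

end AffineAlgebraicDeRham

end Literature.AlgebraicGeometry.Motives

end
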